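import Summits.PneNP.PneNP.Theorems.KrwChromaticSteeringStrongCompositionLradState

/-!
# Crux line `lrad-gluing` (stmt-PneNP-18538), the glued adversary III: single-row steps

M3's public row step (`Cruxes/StrongComposition/LensNegationP5g17.lean` §3 `row_step_alice/bob`) run on the
row-set factor of the fibred state (closed skeleton `Cruxes/StrongComposition/Lines/lrad_gluing.lean` §8, commit
5a5f8789ebd3): at a single-row test on a NON-ALGEBRAIC row `i` (so row `i` carries no equation) either one
answer keeps every realisable orientation of row `i` undamaged — only `K` drops by one — or the adversary fixes
the sender's label at `i` (`ℓ − 1` by subadditivity) and follows an answer undamaged for the surviving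
orientation, whose constant-side count rises by one.  The common system `E` and the budget `k` are untouched;
the typing sends row `i` to `combinatorial` (`StateOK.rowChild_left/right`).

FRONTIER rung of the KRW programme; nothing here bears on P vs NP.
-/

set_option linter.dupNamespace false -- `Summit.PneNP.PneNP.…`: summit = sub-problem name (D-0017 single-conjunct layout)
set_option autoImplicit false

namespace Summit.PneNP.PneNP.Theorems.KrwLrad

open Literature.Computability.Complexity

universe u

section RowSteps

variable {m n : ℕ} {g : (Fin n → Bool) → Bool} {q : ℕ}

/-- ALICE SINGLE-ROW TEST on a non-algebraic row `i` [M3's `row_step_alice` on the row-set factor]: either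
one answer keeps every realisable orientation of row `i` undamaged (then only `K` drops by one), or the
adversary fixes Alice's label `a_i` (costing `ℓ` at most one) and follows an answer undamaged for the
surviving orientation, whose constant-side count goes up by one.  `E`, `k` are untouched. -/
theorem row_stepAt_alice (i₀ : Fin m) (j₀ : Fin n) {τ : Fin m → RowType}
    {s : (Fin m × Fin n → Bool) → Bool} {P Q : KWTree (Fin m × Fin n)} {i : Fin m}
    {ψ : (Fin n → Bool) → Bool} (hψ : ∀ X, s X = ψ (row X i)) (hτi : τ i ≠ RowType.algebraic)
    (hIP : InvAt g q (Function.update τ i RowType.combinatorial) P)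
    (hIQ : InvAt g q (Function.update τ i RowType.combinatorial) Q) :
    InvAt g q τ (KWTree.alice s P Q) := by
  classical
  intro A B S T E k hst hsat hload hV hD hneA hneB ℓ K r hL hR hK
  -- `Good β α`: after the answer `β` the Alice part of the row game `(i, α)` is nonempty and (if the
  -- orientation is alive) still needs depth `r i α - 1`.
  let Good : Bool → Bool → Prop := fun β α =>
    (RA g S i α ∩ {x | ψ x = β}).Nonempty ∧
      (Alive g A B S T i α → Hard (RA g S i α ∩ {x | ψ x = β}) (RA g T i (!α)) (r i α - 1))
  have G : ∀ α, (∃ a ∈ AE g A S, a i = α) → ∃ β, Good β α := by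
    rintro α ⟨a, ha, hai⟩
    obtain ⟨x, hx, hgx⟩ := ha.2 i
    have hxα : x ∈ RA g S i α := ⟨hx, by rw [Set.mem_setOf_eq, hgx, hai]⟩
    by_cases hal : Alive g A B S T i α
    · obtain ⟨β, hβne, hβH⟩ := (hR i α hal).split_alice ⟨x, hxα⟩ j₀ ψ
      exact ⟨β, hβne, fun _ => hβH⟩
    · exact ⟨ψ x, ⟨x, hxα, rfl⟩, fun h => (hal h).elim⟩
  by_cases hA : ∃ β, ∀ α, (∃ a ∈ AE g A S, a i = α) → Good β α
  · -- CASE A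
    obtain ⟨β, hgood⟩ := hA
    obtain ⟨C, hIC, hCd, hrun⟩ := alice_childAt (s := s) hIP hIQ β
    set S' := rowChild S i ψ β with hS'
    have hst' : StateOK (Function.update τ i RowType.combinatorial) S' T E :=
      hst.rowChild_left hτi ψ β
    have hAE : AE g A S' = AE g A S := by
      refine Set.Subset.antisymm (AE_rowChild_subset A S i ψ β) fun a ha => ?_
      exact mem_AE_rowChild ha (hgood (a i) ⟨a, ha, rfl⟩).1
    have hV' : ValidOnE g C A B S' T E := by
      intro X hX Y hY
      rw [hS', XSetE_rowChild] at hX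
      have hsX : s X = β := by rw [hψ X]; exact hX.2
      have := hV X hX.1 Y hY
      rwa [hrun X Y hsX] at this
    have hD' : ∀ a ∈ AE g A S', ∀ b ∈ AE g B T, a ≠ b := by rw [hAE]; exact hD
    have hneA' : (AE g A S').Nonempty := by rw [hAE]; exact hneA
    have hL' : Hard (AE g A S') (AE g B T) ℓ := by rw [hAE]; exact hL
    let r' : Fin m → Bool → ℕ := fun i' α => if i' = i then r i α - 1 else r i' α
    have hR' : ∀ i' α, Alive g A B S' T i' α → Hard (RA g S' i' α) (RA g T i' (!α)) (r' i' α) := by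
      intro i' α hal
      have hal0 : Alive g A B S T i' α := hal.mono (by rw [hAE]) (fun _ h => h)
      by_cases h : i' = i
      · subst h
        have hr' : r' i' α = r i' α - 1 := by simp [r']
        rw [hr', hS', RA_rowChild_self]
        exact (hgood α hal0.1).2 hal0
      · have hr' : r' i' α = r i' α := by simp [r', h]
        rw [hr', hS', RA_rowChild_of_ne _ _ _ _ h]
        exact hR i' α hal0
    have hK' : ∀ i' α, Alive g A B S' T i' α →
        K - 1 ≤ r' i' α + cst (AE g A S') i' + cst (AE g B T) i' := by
      intro i' α hal
      have hal0 : Alive g A B S T i' α := hal.mono (by rw [hAE]) (fun _ h => h)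
      have hk := hK i' α hal0
      rw [hAE]
      by_cases h : i' = i
      · subst h
        have hr' : r' i' α = r i' α - 1 := by simp [r']
        rw [hr']; omega
      · have hr' : r' i' α = r i' α := by simp [r', h]
        rw [hr']; omega
    have := hIC A B S' T E k hst' hsat hload hV' hD' hneA' hneB ℓ (K - 1) r' hL' hR' hK'
    simp only [KWTree.depth_alice]
    omega
  · -- CASE B
    have hA' : ∀ β, ∃ α, (∃ a ∈ AE g A S, a i = α) ∧ ¬ Good β α := by
      intro β
      by_contra hcon
      exact hA ⟨β, fun α hα => by by_contra hbad; exact hcon ⟨α, hα, hbad⟩⟩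
    obtain ⟨v, hne, hH⟩ := hL.split_alice hneA i₀ (fun a => a i)
    obtain ⟨a₁, ha₁, ha₁i⟩ := hne
    have ha₁i : a₁ i = v := ha₁i
    obtain ⟨β, hβne, hβH⟩ := G v ⟨a₁, ha₁, ha₁i⟩
    obtain ⟨α₂, ⟨a₂, ha₂, ha₂i⟩, hbad⟩ := hA' β
    have hα₂ : α₂ ≠ v := by rintro rfl; exact hbad ⟨hβne, hβH⟩
    have hcst0 : cst (AE g A S) i = 0 :=
      cst_eq_zero ha₁ ha₂ (by rw [ha₁i, ha₂i]; exact Ne.symm hα₂)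
    obtain ⟨C, hIC, hCd, hrun⟩ := alice_childAt (s := s) hIP hIQ β
    set S' := rowChild S i ψ β with hS'
    have hst' : StateOK (Function.update τ i RowType.combinatorial) S' T E :=
      hst.rowChild_left hτi ψ β
    set A' : Set (Fin m → Bool) := A ∩ {a | a i = v} with hA'def
    have hAE : AE g A' S' = AE g A S ∩ {a | a i = v} := by
      ext a
      constructor
      · intro ha
        have ha0 : a ∈ AE g A S' := ⟨ha.1.1, ha.2⟩
        exact ⟨AE_rowChild_subset A S i ψ β ha0, ha.1.2⟩
      · rintro ⟨ha, hai⟩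
        have hai : a i = v := hai
        have h' := mem_AE_rowChild (ψ := ψ) (β := β) ha (by rw [hai]; exact hβne)
        exact ⟨⟨ha.1, hai⟩, h'.2⟩
    have hsub : AE g A' S' ⊆ AE g A S := by rw [hAE]; exact Set.inter_subset_left
    have hV' : ValidOnE g C A' B S' T E := by
      intro X hX Y hY
      have hX0 : X ∈ XSetE g A S' E := ⟨hX.1.1, hX.2⟩
      rw [hS', XSetE_rowChild] at hX0
      have hsX : s X = β := by rw [hψ X]; exact hX0.2
      have := hV X hX0.1 Y hY
      rwa [hrun X Y hsX] at this
    have hD' : ∀ a ∈ AE g A' S', ∀ b ∈ AE g B T, a ≠ b := fun a ha b hb => hD a (hsub ha) b hb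
    have hneA' : (AE g A' S').Nonempty := by rw [hAE]; exact ⟨a₁, ha₁, ha₁i⟩
    have hL' : Hard (AE g A' S') (AE g B T) (ℓ - 1) := by rw [hAE]; exact hH
    let r' : Fin m → Bool → ℕ := fun i' α => if i' = i then r i α - 1 else r i' α
    have hR' : ∀ i' α, Alive g A' B S' T i' α → Hard (RA g S' i' α) (RA g T i' (!α)) (r' i' α) := by
      intro i' α hal
      have hal0 : Alive g A B S T i' α := hal.mono hsub (fun _ h => h)
      by_cases h : i' = i
      · subst h
        obtain ⟨⟨a, ha, hai⟩, -⟩ := hal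
        rw [hAE] at ha
        have hαv : α = v := by rw [← hai]; exact ha.2
        subst hαv
        have hr' : r' i' α = r i' α - 1 := by simp [r']
        rw [hr', hS', RA_rowChild_self]
        exact hβH hal0
      · have hr' : r' i' α = r i' α := by simp [r', h]
        rw [hr', hS', RA_rowChild_of_ne _ _ _ _ h]
        exact hR i' α hal0
    have hK' : ∀ i' α, Alive g A' B S' T i' α →
        K ≤ r' i' α + cst (AE g A' S') i' + cst (AE g B T) i' := by
      intro i' α hal
      have hal0 : Alive g A B S T i' α := hal.mono hsub (fun _ h => h)
      have hk := hK i' α hal0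
      have hc := cst_mono hsub i'
      by_cases h : i' = i
      · subst h
        obtain ⟨⟨a, ha, hai⟩, -⟩ := hal
        rw [hAE] at ha
        have hαv : α = v := by rw [← hai]; exact ha.2
        subst hαv
        have hr' : r' i' α = r i' α - 1 := by simp [r']
        have hc1 : cst (AE g A' S') i' = 1 := cst_eq_one (v := α) (fun a' ha' => by
          rw [hAE] at ha'; exact ha'.2)
        rw [hr', hc1]
        rw [hcst0] at hk
        omega
      · have hr' : r' i' α = r i' α := by simp [r', h]
        rw [hr']; omega
    have := hIC A' B S' T E k hst' hsat hload hV' hD' hneA' hneB (ℓ - 1) K r' hL' hR' hK'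
    simp only [KWTree.depth_alice]
    omega

/-- BOB SINGLE-ROW TEST on a non-algebraic row `i` (mirror image of `row_stepAt_alice`). -/
theorem row_stepAt_bob (i₀ : Fin m) (j₀ : Fin n) {τ : Fin m → RowType}
    {s : (Fin m × Fin n → Bool) → Bool} {P Q : KWTree (Fin m × Fin n)} {i : Fin m}
    {ψ : (Fin n → Bool) → Bool} (hψ : ∀ Y, s Y = ψ (row Y i)) (hτi : τ i ≠ RowType.algebraic)
    (hIP : InvAt g q (Function.update τ i RowType.combinatorial) P)
    (hIQ : InvAt g q (Function.update τ i RowType.combinatorial) Q) :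
    InvAt g q τ (KWTree.bob s P Q) := by
  classical
  intro A B S T E k hst hsat hload hV hD hneA hneB ℓ K r hL hR hK
  let Good : Bool → Bool → Prop := fun β α =>
    (RA g T i (!α) ∩ {y | ψ y = β}).Nonempty ∧
      (Alive g A B S T i α → Hard (RA g S i α) (RA g T i (!α) ∩ {y | ψ y = β}) (r i α - 1))
  have G : ∀ α, (∃ b ∈ AE g B T, b i = !α) → ∃ β, Good β α := by
    rintro α ⟨b, hb, hbi⟩
    obtain ⟨y, hy, hgy⟩ := hb.2 i
    have hyα : y ∈ RA g T i (!α) := ⟨hy, by rw [Set.mem_setOf_eq, hgy, hbi]⟩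
    by_cases hal : Alive g A B S T i α
    · obtain ⟨β, hβne, hβH⟩ := (hR i α hal).split_bob ⟨y, hyα⟩ j₀ ψ
      exact ⟨β, hβne, fun _ => hβH⟩
    · exact ⟨ψ y, ⟨y, hyα, rfl⟩, fun h => (hal h).elim⟩
  by_cases hA : ∃ β, ∀ α, (∃ b ∈ AE g B T, b i = !α) → Good β α
  · -- CASE A
    obtain ⟨β, hgood⟩ := hA
    obtain ⟨C, hIC, hCd, hrun⟩ := bob_childAt (s := s) hIP hIQ β
    set T' := rowChild T i ψ β with hT'
    have hst' : StateOK (Function.update τ i RowType.combinatorial) S T' E :=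
      hst.rowChild_right hτi ψ β
    have hAE : AE g B T' = AE g B T := by
      refine Set.Subset.antisymm (AE_rowChild_subset B T i ψ β) fun b hb => ?_
      have h1 := (hgood (!(b i)) ⟨b, hb, by simp⟩).1
      simp only [Bool.not_not] at h1
      exact mem_AE_rowChild hb h1
    have hV' : ValidOnE g C A B S T' E := by
      intro X hX Y hY
      rw [hT', XSetE_rowChild] at hY
      have hsY : s Y = β := by rw [hψ Y]; exact hY.2
      have := hV X hX Y hY.1
      rwa [hrun X Y hsY] at this
    have hD' : ∀ a ∈ AE g A S, ∀ b ∈ AE g B T', a ≠ b := by rw [hAE]; exact hD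
    have hneB' : (AE g B T').Nonempty := by rw [hAE]; exact hneB
    have hL' : Hard (AE g A S) (AE g B T') ℓ := by rw [hAE]; exact hL
    let r' : Fin m → Bool → ℕ := fun i' α => if i' = i then r i α - 1 else r i' α
    have hR' : ∀ i' α, Alive g A B S T' i' α → Hard (RA g S i' α) (RA g T' i' (!α)) (r' i' α) := by
      intro i' α hal
      have hal0 : Alive g A B S T i' α := hal.mono (fun _ h => h) (by rw [hAE])
      by_cases h : i' = i
      · subst h
        have hr' : r' i' α = r i' α - 1 := by simp [r']
        rw [hr', hT', RA_rowChild_self]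
        exact (hgood α hal0.2).2 hal0
      · have hr' : r' i' α = r i' α := by simp [r', h]
        rw [hr', hT', RA_rowChild_of_ne _ _ _ _ h]
        exact hR i' α hal0
    have hK' : ∀ i' α, Alive g A B S T' i' α →
        K - 1 ≤ r' i' α + cst (AE g A S) i' + cst (AE g B T') i' := by
      intro i' α hal
      have hal0 : Alive g A B S T i' α := hal.mono (fun _ h => h) (by rw [hAE])
      have hk := hK i' α hal0
      rw [hAE]
      by_cases h : i' = i
      · subst h
        have hr' : r' i' α = r i' α - 1 := by simp [r']
        rw [hr']; omega
      · have hr' : r' i' α = r i' α := by simp [r', h]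
        rw [hr']; omega
    have := hIC A B S T' E k hst' hsat hload hV' hD' hneA hneB' ℓ (K - 1) r' hL' hR' hK'
    simp only [KWTree.depth_bob]
    omega
  · -- CASE B
    have hA' : ∀ β, ∃ α, (∃ b ∈ AE g B T, b i = !α) ∧ ¬ Good β α := by
      intro β
      by_contra hcon
      exact hA ⟨β, fun α hα => by by_contra hbad; exact hcon ⟨α, hα, hbad⟩⟩
    obtain ⟨w, hne, hH⟩ := hL.split_bob hneB i₀ (fun b => b i)
    obtain ⟨b₁, hb₁, hb₁i⟩ := hne
    have hb₁i : b₁ i = w := hb₁i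
    obtain ⟨β, hβne0, hβH0⟩ := G (!w) ⟨b₁, hb₁, by rw [hb₁i, Bool.not_not]⟩
    have hβne : (RA g T i w ∩ {y | ψ y = β}).Nonempty := by simpa only [Bool.not_not] using hβne0
    have hβH : Alive g A B S T i (!w) →
        Hard (RA g S i (!w)) (RA g T i w ∩ {y | ψ y = β}) (r i (!w) - 1) := by
      simpa only [Bool.not_not] using hβH0
    obtain ⟨α₂, ⟨b₂, hb₂, hb₂i⟩, hbad⟩ := hA' β
    have hα₂ : α₂ ≠ !w := by rintro rfl; exact hbad ⟨hβne0, hβH0⟩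
    have hcst0 : cst (AE g B T) i = 0 :=
      cst_eq_zero hb₁ hb₂ (by rw [hb₁i, hb₂i]; cases α₂ <;> cases w <;> simp_all)
    obtain ⟨C, hIC, hCd, hrun⟩ := bob_childAt (s := s) hIP hIQ β
    set T' := rowChild T i ψ β with hT'
    have hst' : StateOK (Function.update τ i RowType.combinatorial) S T' E :=
      hst.rowChild_right hτi ψ β
    set B' : Set (Fin m → Bool) := B ∩ {b | b i = w} with hB'def
    have hAE : AE g B' T' = AE g B T ∩ {b | b i = w} := by
      ext b
      constructor
      · intro hb
        have hb0 : b ∈ AE g B T' := ⟨hb.1.1, hb.2⟩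
        exact ⟨AE_rowChild_subset B T i ψ β hb0, hb.1.2⟩
      · rintro ⟨hb, hbi⟩
        have hbi : b i = w := hbi
        have h' := mem_AE_rowChild (ψ := ψ) (β := β) hb (by rw [hbi]; exact hβne)
        exact ⟨⟨hb.1, hbi⟩, h'.2⟩
    have hsub : AE g B' T' ⊆ AE g B T := by rw [hAE]; exact Set.inter_subset_left
    have hV' : ValidOnE g C A B' S T' E := by
      intro X hX Y hY
      have hY0 : Y ∈ XSetE g B T' E := ⟨hY.1.1, hY.2⟩
      rw [hT', XSetE_rowChild] at hY0
      have hsY : s Y = β := by rw [hψ Y]; exact hY0.2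
      have := hV X hX Y hY0.1
      rwa [hrun X Y hsY] at this
    have hD' : ∀ a ∈ AE g A S, ∀ b ∈ AE g B' T', a ≠ b := fun a ha b hb => hD a ha b (hsub hb)
    have hneB' : (AE g B' T').Nonempty := by rw [hAE]; exact ⟨b₁, hb₁, hb₁i⟩
    have hL' : Hard (AE g A S) (AE g B' T') (ℓ - 1) := by rw [hAE]; exact hH
    let r' : Fin m → Bool → ℕ := fun i' α => if i' = i then r i α - 1 else r i' α
    have hR' : ∀ i' α, Alive g A B' S T' i' α → Hard (RA g S i' α) (RA g T' i' (!α)) (r' i' α) := by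
      intro i' α hal
      have hal0 : Alive g A B S T i' α := hal.mono (fun _ h => h) hsub
      by_cases h : i' = i
      · subst h
        obtain ⟨-, ⟨b, hb, hbi⟩⟩ := hal
        rw [hAE] at hb
        have hαw : α = !w := by
          have : b i' = w := hb.2
          rw [this] at hbi
          rw [hbi, Bool.not_not]
        subst hαw
        have hr' : r' i' (!w) = r i' (!w) - 1 := by simp [r']
        rw [hr', Bool.not_not, hT', RA_rowChild_self]
        exact hβH hal0
      · have hr' : r' i' α = r i' α := by simp [r', h]
        rw [hr', hT', RA_rowChild_of_ne _ _ _ _ h]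
        exact hR i' α hal0
    have hK' : ∀ i' α, Alive g A B' S T' i' α →
        K ≤ r' i' α + cst (AE g A S) i' + cst (AE g B' T') i' := by
      intro i' α hal
      have hal0 : Alive g A B S T i' α := hal.mono (fun _ h => h) hsub
      have hk := hK i' α hal0
      have hc := cst_mono hsub i'
      by_cases h : i' = i
      · subst h
        obtain ⟨-, ⟨b, hb, hbi⟩⟩ := hal
        rw [hAE] at hb
        have hαw : α = !w := by
          have : b i' = w := hb.2
          rw [this] at hbi
          rw [hbi, Bool.not_not]
        subst hαw
        have hr' : r' i' (!w) = r i' (!w) - 1 := by simp [r']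
        have hc1 : cst (AE g B' T') i' = 1 := cst_eq_one (v := w) (fun b' hb' => by
          rw [hAE] at hb'; exact hb'.2)
        rw [hr', hc1]
        rw [hcst0] at hk
        omega
      · have hr' : r' i' α = r i' α := by simp [r', h]
        rw [hr']; omega
    have := hIC A B' S T' E k hst' hsat hload hV' hD' hneA hneB' (ℓ - 1) K r' hL' hR' hK'
    simp only [KWTree.depth_bob]
    omega

end RowSteps

end Summit.PneNP.PneNP.Theorems.KrwLrad
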